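import Summits.MatrixMultiplication.MatrixMultiplication.Theses.DefinableSTPPDichotomy

/-!
# `PairwiseCurvedTilingsLC` (crux stmt-MatrixMultiplication-17883): a common translate inside one
colour class costs its size in the complementary packing

Negative-side lemmas from the refuter's crux attack (gen 2); elementary and sorry-free.  They
strictly generalise the three packing bounds `Σ|A||C|, Σ|B||C|, Σ|A||B| ≤ |H|` of a pairwise-STPP
family (the case `T = {t₀}` below) and contain the heart of the support item `TranslateFamiliesFail`
(stmt-MatrixMultiplication-17885; the case in which all three classes are translates).

Let `(A_x, B_x, C_x)_{x ∈ I}` satisfy the route's PAIRWISE STPP clause (the STPP relation for every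
label triple with at least two equal entries — verbatim the clause of `PairwiseCurvedTilingsLC` and
`HexagonClearanceR`) in a finite abelian group `H`, let `X ⊆ I` and let `T ⊆ H` be a finite set.

* `sum_card_AC_mul_card_le` — if every `B_x`, `x ∈ X`, contains a translate `β_x + T`, then
  `(x, a, c, t) ↦ a − c + t` is injective on `⨆_{x ∈ X} A_x × C_x × T` (pattern `i = j ≠ k` read with
  the two `B_i`-elements `β_x + t'` and `β_x + t`), hence `(Σ_{x ∈ X} |A_x||C_x|) · |T| ≤ |H|`;
* `sum_card_BC_mul_card_le` — the same with a common translate `α_x + T ⊆ A_x` (pattern `k = i`):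
  `(Σ_{x ∈ X} |B_x||C_x|) · |T| ≤ |H|`;
* `sum_card_AB_mul_card_le` — the same with `γ_x + T ⊆ C_x` (pattern `j = k`):
  `(Σ_{x ∈ X} |A_x||B_x|) · |T| ≤ |H|`.

Consequences for the crux (its docstring numerology: blocks of dimension type `(d,d,d)`, `≍ |F|^{m−2d}`
of them, all three packings tight up to constants):
(i) NO SINGLE colour class of a witness can consist of translates of one set — e.g. `B_x = β_x + B`
for all `x` gives `Σ_x |A_x||C_x| ≤ |F|^m / |B|`, i.e. at most `≍ |F|^{m−3d}` blocks instead of the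
required `≍ |F|^{m−2d}` (`TranslateFamiliesFail` excludes only families in which ALL THREE classes are
translates);
(ii) more generally, for any set `T` with `|T| ≥ |F|^κ`, the blocks whose `B`-sets (resp. `A`-, `C`-sets)
contain a translate of `T` carry `A–C` (resp. `B–C`, `A–B`) packing mass `≤ |F|^{m−κ}`, so they number
`≲ |F|^{m−2d−κ}` — a vanishing fraction.  In every class the shapes `B_x − β_x` must vary with the
label in the strong sense of having no common part of positive dimension across `≍ |F|^{m−2d}` labels.

References: J. Blasiak, T. Church, H. Cohn, J. A. Grochow, E. Naslund, W. F. Sawin, C. Umans,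
Discrete Analysis 2017:3 (arXiv:1605.06702) §2 (packing bounds); H. Cohn, R. Kleinberg, B. Szegedy,
C. Umans, FOCS 2005 (arXiv:math/0511460) Def. 5.1.
-/

set_option linter.dupNamespace false  -- `Summit.<S>.<S>.…` is the mandated namespace

namespace Summit.MatrixMultiplication.MatrixMultiplication.Theorems.PairwiseCurvedTilingsLC.Negative

open Finset

section CommonTranslate

variable {H : Type*} [AddCommGroup H] {ι : Type*} {I : Finset ι} {A B C : ι → Finset H}
  (hP : ∀ i ∈ I, ∀ j ∈ I, ∀ k ∈ I, (i = j ∨ j = k ∨ k = i) →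
    ∀ s ∈ A k, ∀ s' ∈ A i, ∀ t ∈ B i, ∀ t' ∈ B j, ∀ u ∈ C j, ∀ u' ∈ C k,
      (s' - s) + (t' - t) + (u' - u) = 0 → i = j ∧ j = k ∧ s = s' ∧ t = t' ∧ u = u')
include hP

/-- **A common translate in the `B`-class costs `|T|` in the `A–C` packing.**  If every `B_x`
(`x ∈ X ⊆ I`) contains `β_x + T`, then `(x, a, c, t) ↦ a − c + t` is injective on
`⨆_{x ∈ X} A_x × C_x × T`, so `(Σ_{x ∈ X} |A_x||C_x|) · |T| ≤ |H|`.  (Pattern `i = j = x`, `k = x'` of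
the pairwise clause with `B_i`-elements `β_x + t'`, `β_x + t`.)  [folklore-type packing count] -/
theorem sum_card_AC_mul_card_le [Fintype H] {X : Finset ι} (hX : X ⊆ I) (T : Finset H)
    (β : ι → H) (hT : ∀ x ∈ X, ∀ t ∈ T, β x + t ∈ B x) :
    (∑ x ∈ X, (A x).card * (C x).card) * T.card ≤ Fintype.card H := by
  have hinj : Set.InjOn (fun p : (Σ _ : ι, (H × H) × H) => p.2.1.1 - p.2.1.2 + p.2.2)
      ↑(X.sigma fun x => (A x ×ˢ C x) ×ˢ T) := by
    rintro ⟨x, ⟨a, c⟩, t⟩ hp ⟨x', ⟨a', c'⟩, t'⟩ hp' he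
    simp only [mem_coe, mem_sigma, mem_product] at hp hp'
    change a - c + t = a' - c' + t' at he
    obtain ⟨hx, ⟨ha, hc⟩, ht⟩ := hp
    obtain ⟨hx', ⟨ha', hc'⟩, ht'⟩ := hp'
    have h0 : (a - a') + ((β x + t) - (β x + t')) + (c' - c) = 0 := by
      have : (a - a') + ((β x + t) - (β x + t')) + (c' - c) = (a - c + t) - (a' - c' + t') := by
        abel
      rw [this, he, sub_self]
    obtain ⟨-, h1, h2, h3, h4⟩ := hP x (hX hx) x (hX hx) x' (hX hx') (Or.inl rfl) a' ha' a ha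
      (β x + t') (hT x hx t' ht') (β x + t) (hT x hx t ht) c hc c' hc' h0
    have h3' : t' = t := add_left_cancel h3
    subst h1 h2 h4 h3'
    rfl
  calc (∑ x ∈ X, (A x).card * (C x).card) * T.card
      = (X.sigma fun x => (A x ×ˢ C x) ×ˢ T).card := by
        rw [card_sigma, Finset.sum_mul]; simp only [card_product]
    _ ≤ (univ : Finset H).card := card_le_card_of_injOn _ (fun _ _ => mem_univ _) hinj
    _ = Fintype.card H := card_univ

/-- **A common translate in the `A`-class costs `|T|` in the `B–C` packing.**  If every `A_x`
(`x ∈ X ⊆ I`) contains `α_x + T`, then `(x, b, c, t) ↦ b − c + t` is injective on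
`⨆_{x ∈ X} B_x × C_x × T`, so `(Σ_{x ∈ X} |B_x||C_x|) · |T| ≤ |H|`.  (Pattern `k = i = x'`, `j = x` with
`A_i`-elements `α_{x'} + t'`, `α_{x'} + t`.)  [folklore-type packing count] -/
theorem sum_card_BC_mul_card_le [Fintype H] {X : Finset ι} (hX : X ⊆ I) (T : Finset H)
    (α : ι → H) (hT : ∀ x ∈ X, ∀ t ∈ T, α x + t ∈ A x) :
    (∑ x ∈ X, (B x).card * (C x).card) * T.card ≤ Fintype.card H := by
  have hinj : Set.InjOn (fun p : (Σ _ : ι, (H × H) × H) => p.2.1.1 - p.2.1.2 + p.2.2)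
      ↑(X.sigma fun x => (B x ×ˢ C x) ×ˢ T) := by
    rintro ⟨x, ⟨b, c⟩, t⟩ hp ⟨x', ⟨b', c'⟩, t'⟩ hp' he
    simp only [mem_coe, mem_sigma, mem_product] at hp hp'
    change b - c + t = b' - c' + t' at he
    obtain ⟨hx, ⟨hb, hc⟩, ht⟩ := hp
    obtain ⟨hx', ⟨hb', hc'⟩, ht'⟩ := hp'
    have h0 : ((α x' + t) - (α x' + t')) + (b - b') + (c' - c) = 0 := by
      have : ((α x' + t) - (α x' + t')) + (b - b') + (c' - c) = (b - c + t) - (b' - c' + t') := by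
        abel
      rw [this, he, sub_self]
    obtain ⟨h1, -, h2, h3, h4⟩ := hP x' (hX hx') x (hX hx) x' (hX hx') (Or.inr (Or.inr rfl))
      (α x' + t') (hT x' hx' t' ht') (α x' + t) (hT x' hx' t ht) b' hb' b hb c hc c' hc' h0
    have h2' : t' = t := add_left_cancel h2
    subst h1 h3 h4 h2'
    rfl
  calc (∑ x ∈ X, (B x).card * (C x).card) * T.card
      = (X.sigma fun x => (B x ×ˢ C x) ×ˢ T).card := by
        rw [card_sigma, Finset.sum_mul]; simp only [card_product]
    _ ≤ (univ : Finset H).card := card_le_card_of_injOn _ (fun _ _ => mem_univ _) hinj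
    _ = Fintype.card H := card_univ

/-- **A common translate in the `C`-class costs `|T|` in the `A–B` packing.**  If every `C_x`
(`x ∈ X ⊆ I`) contains `γ_x + T`, then `(x, a, b, t) ↦ a − b + t` is injective on
`⨆_{x ∈ X} A_x × B_x × T`, so `(Σ_{x ∈ X} |A_x||B_x|) · |T| ≤ |H|`.  (Pattern `j = k = x'`, `i = x` with
`C_k`-elements `γ_{x'} + t'`, `γ_{x'} + t`.)  [folklore-type packing count] -/
theorem sum_card_AB_mul_card_le [Fintype H] {X : Finset ι} (hX : X ⊆ I) (T : Finset H)
    (γ : ι → H) (hT : ∀ x ∈ X, ∀ t ∈ T, γ x + t ∈ C x) :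
    (∑ x ∈ X, (A x).card * (B x).card) * T.card ≤ Fintype.card H := by
  have hinj : Set.InjOn (fun p : (Σ _ : ι, (H × H) × H) => p.2.1.1 - p.2.1.2 + p.2.2)
      ↑(X.sigma fun x => (A x ×ˢ B x) ×ˢ T) := by
    rintro ⟨x, ⟨a, b⟩, t⟩ hp ⟨x', ⟨a', b'⟩, t'⟩ hp' he
    simp only [mem_coe, mem_sigma, mem_product] at hp hp'
    change a - b + t = a' - b' + t' at he
    obtain ⟨hx, ⟨ha, hb⟩, ht⟩ := hp
    obtain ⟨hx', ⟨ha', hb'⟩, ht'⟩ := hp'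
    have h0 : (a - a') + (b' - b) + ((γ x' + t) - (γ x' + t')) = 0 := by
      have : (a - a') + (b' - b) + ((γ x' + t) - (γ x' + t')) = (a - b + t) - (a' - b' + t') := by
        abel
      rw [this, he, sub_self]
    obtain ⟨h1, -, h2, h3, h4⟩ := hP x (hX hx) x' (hX hx') x' (hX hx') (Or.inr (Or.inl rfl))
      a' ha' a ha b hb b' hb' (γ x' + t') (hT x' hx' t' ht') (γ x' + t) (hT x' hx' t ht) h0
    have h4' : t' = t := add_left_cancel h4
    subst h1 h2 h3 h4'
    rfl
  calc (∑ x ∈ X, (A x).card * (B x).card) * T.card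
      = (X.sigma fun x => (A x ×ˢ B x) ×ˢ T).card := by
        rw [card_sigma, Finset.sum_mul]; simp only [card_product]
    _ ≤ (univ : Finset H).card := card_le_card_of_injOn _ (fun _ _ => mem_univ _) hinj
    _ = Fintype.card H := card_univ

end CommonTranslate

end Summit.MatrixMultiplication.MatrixMultiplication.Theorems.PairwiseCurvedTilingsLC.Negative
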